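import Literature.AlgebraicGeometry.ShimuraVarieties.UnitaryCurveAuxiliarySiegelChartMover
import Literature.AlgebraicGeometry.ShimuraVarieties.UnitaryCurveAuxiliarySymplecticFrameV
import Literature.AlgebraicGeometry.Deligne1982.ConstantSumSplitHermitianForm
import Literature.AlgebraicGeometry.ShimuraVarieties.UnitaryBallTranslatedSubdiscClosed
import HarnessLib

/-!
# Deligne's complex structure `J_Φ(v)` is unchanged by rescaling the hermitian form, and its positivity from a
# signature datum for `t • J⋆`

Topic `AlgebraicGeometry/ShimuraVarieties`; namespaces `Literature.AlgebraicGeometry.ShimuraVarieties.UnitaryCurve.AuxV` (§1–§3, any rank) and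
`Literature.AlgebraicGeometry.ShimuraVarieties.UnitaryCurve` (§4–§5, the curve).  THEOREMS ONLY (no `def`, no named fact, no instance, no notation,
no `sorry`).  Cell `hodgecm-mathlib` (D-0151), FLOOR 0, P6 «MOD programme», door (E) of `stub_RGD`, E-line `F0_P6a_PELWitnessE` (`stub_E123`, binder
`(_hsig : SigDatum F ι₁ Jstar)` of ED. 3).  `--supports stmt-HodgeConjecture-24832`, count-neutral; HC_CM is proved only modulo the printed citations
until rung 0 closes.

THE POINT.  The record (`RecordSystemGS`) types every group at the hermitian matrix `J⋆`, while the signature datum only says that a RESCALED form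
`t • J⋆` (`t ∈ F⁺`, `ι₁(t) > 0`) has signature `(1,1)` at `ι₁` and is definite off `ι₁` (★ `UnitaryCurveSignatureDistilled`,
`exists_sigDatum_of_formCongr_diagonal`).  Deligne's `h(i) = iPhi · s_v` ([Deligne1979ShimuraVarieties] Prop. 2.3.10; [RapoportSmithlingZhang2020Diagonal]
Remark 3.2 (iii)) depends on the form only through the `H^τ`-REFLECTION in the negative line `ℂv`, which is the same for `H` and `t • H`; and the
trace form `ψ_V = Tr(ξ·ᵗc(x)·H^j·y)` ([Milne2005ShimuraVarieties] §8 p. 81) is the same for `(H, ξ)` and `(t • H, ξ/t)`.  So a symplectic frame for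
`(J⋆, ξ)` IS a symplectic frame for `(t • J⋆, ξ/t)` with the same coordinates `β`, the complex structures agree, and ★ E2 A3
`auxComplexStructureV_mem_C0pm_of_frame` applied to the rescaled frame gives positivity for the ORIGINAL one — no transport of unitary groups
`U(t • J⋆) = U(J⋆)` is needed.

* §1 `formH_smul_form`, `projH_smul_form`, `reflH_smul_form` (`r_v` for `c • Hc` = `r_v` for `Hc`, `c ≠ 0`).
* §2 `sCompV_smul_form`, `sMatV_smul_form`, `sPhiV_smul_form` (`s_v` unchanged under `H ↦ t • H`, `t ≠ 0`).
* §3 `auxGramV_smul_form`, `auxFormV_smul_form` (`ψ_{t•H, ξ/j(t)} = ψ_{H, ξ}`), `exists_symplecticFrameV_smul_form` (a frame for `(t • H, ξ/j(t))` with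
  the same `β`), `framePV_eq_of_β_eq`, `frameQV_eq_of_β_eq`, `auxRepV_eq_of_β_eq`, `auxComplexStructureV_eq_of_β_eq_smul`.
* §4 (the curve, `M = L`, `j = id`) `complexConj_eq_self_of_im_eq_zero`, `transpose_map_complexConj_smul`, `negCone_map_smul_eq`,
  **`auxComplexStructureV_mem_C0pm_of_sigDatum`**, **`neg_auxComplexStructureV_mem_C0_of_sigDatum`** (E3's `hJ`∕`hJneg` from the `SigDatum`-shaped
  binders `t, 0 < Re ι₁ t, Im ι₁ t = 0, T : GL₂(ℂ), Tᴴ (t•J⋆)^{ι₁} T = diag(1,−1), (t•J⋆)^σ ≻ 0 off ι₁` and `Im ρ(ξ/t) < 0` on `Φ`),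
  `exists_xi_of_sigDatum` (a nonzero skew `ξ` with `Im ρ(ξ/t) < 0` on `Φ`, stable under `ξ ↦ k•ξ`, `k > 0`: ★ `exists_skew_adapted`).
* §5 **`exists_siegelChartGS_auxComplexStructureV_mover_of_sigDatum`** — ★ `exists_siegelChartGS_auxComplexStructureV_mover` with its positivity
  binders `(T Ti hT hTi hpos)` at `J⋆` and `hξ` replaced by the `SigDatum`-shaped ones; conclusion verbatim (the two `SiegelShimuraSet.mk` membership
  proofs are the §4 ones); proof = the same ★ E3 FILE D `exists_siegelChartGS_mover` call.

## References
* [Deligne1979ShimuraVarieties] P. Deligne, *Variétés de Shimura* (1979), Prop. 2.3.10 (PDF p. 32 of Milne's translation).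
* [RapoportSmithlingZhang2020Diagonal] M. Rapoport, B. Smithling, W. Zhang, *Arithmetic diagonal cycles on unitary Shimura varieties*,
  Compos. Math. 156 (2020), Remark 3.2 (ii)(iii), Remark 3.3 pp. 9–10.
* [Milne2005ShimuraVarieties] J. S. Milne, *Introduction to Shimura varieties* (2005), §6 pp. 67–69, §8 p. 81.
* [Shimura1998] G. Shimura, *Abelian varieties with complex multiplication and modular functions* (1998), §6.2 Thm. 3 (pp. 37–38).
* [BergeronMillsonMoeglin2016Balls] N. Bergeron, J. Millson, C. Moeglin, *The Hodge conjecture and arithmetic quotients of complex balls*,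
  Acta Math. 216 (2016), Part 2 §1.3.
-/

set_option autoImplicit false

noncomputable section

open Function Matrix NumberField IsDedekindDomain CategoryTheory CategoryTheory.Limits AlgebraicGeometry
open scoped Matrix ComplexOrder TensorProduct ComplexConjugate
open Literature.AlgebraicGeometry.Motives (SchemeOver ComplexPoints AlgPoints specOver CMType)
open Literature.AlgebraicGeometry.AbelianSchemes (PolarizedAbelianSchemeWithLevel)
open Literature.NumberTheory.Automorphic (siegelUpperHalfSpace)
open Literature.NumberTheory.Automorphic.UnitaryGroup
open Literature.AlgebraicGeometry.ModuliOfAbelianVarieties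
open Literature.AlgebraicGeometry.ModuliOfAbelianVarieties.SiegelModuli (C0 jOfSiegel jOfSiegel_mem_C0)

namespace Literature.AlgebraicGeometry.ShimuraVarieties

open UnitaryCanonicalModel
open Literature.AlgebraicGeometry.ShimuraVarieties.UnitaryCanonicalModel.Aux (IsExtAdapted iPhi ratBasis matrix_eq_of_realEmb_eq)

namespace UnitaryCurve

namespace AuxV

/-! ### §1. The line reflection does not see a rescaling of the form -/

section Reflection

variable {m : Type} [Fintype m] (Hc : Matrix m m ℂ)

/-- `q_{c•Hc}(v) = c · q_{Hc}(v)`. [cite: BergeronMillsonMoeglin2016Balls, Part 2 §1.3] -/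
theorem formH_smul_form (c : ℂ) (v : m → ℂ) : formH (c • Hc) v = c * formH Hc v := by
  rw [formH, formH, Matrix.smul_mulVec, dotProduct_smul, smul_eq_mul]

/-- `P_v` for `c • Hc` is `P_v` for `Hc` (`c ≠ 0`; for `q(v) = 0` both vanish). [cite: Deligne1979ShimuraVarieties, Prop. 2.3.10 (PDF p. 32)] -/
theorem projH_smul_form {c : ℂ} (hc : c ≠ 0) (v : m → ℂ) : projH (c • Hc) v = projH Hc v := by
  have hcc : (c * formH Hc v)⁻¹ * c = (formH Hc v)⁻¹ := by
    rw [mul_inv, mul_right_comm, inv_mul_cancel₀ hc, one_mul]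
  ext i k
  simp only [projH, formH_smul_form, Matrix.smul_apply, Matrix.vecMulVec_apply, Matrix.vecMul_smul, Pi.smul_apply, smul_eq_mul]
  calc (c * formH Hc v)⁻¹ * (v i * (c * (star v ᵥ* Hc) k)) = (c * formH Hc v)⁻¹ * c * (v i * (star v ᵥ* Hc) k) := by ring
    _ = (formH Hc v)⁻¹ * (v i * (star v ᵥ* Hc) k) := by rw [hcc]

variable [DecidableEq m]

/-- **`r_v` for `c • Hc` is `r_v` for `Hc`** (`c ≠ 0`): the reflection in the line `ℂv` depends on the form up to scalars only.
[cite: Deligne1979ShimuraVarieties, Prop. 2.3.10 (PDF p. 32)] [cite: RapoportSmithlingZhang2020Diagonal, Remark 3.3 p. 10] -/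
theorem reflH_smul_form {c : ℂ} (hc : c ≠ 0) (v : m → ℂ) : reflH (c • Hc) v = reflH Hc v := by
  rw [reflH, reflH, projH_smul_form Hc hc]

end Reflection

/-! ### §2. `s_v` does not see `H ↦ t • H` -/

section SPhi

variable {L : Type} [Field L] (M : Type) [Field M] [NumberField M] (j : L →+* M) (Φ : CMType M) (τ : L →+* ℂ)
  {n : ℕ} (H : Matrix (Fin n) (Fin n) L)

omit [NumberField M] in
/-- `Φ`-components of `s_v`: unchanged under `H ↦ t • H`, `t ≠ 0`. [cite: Deligne1979ShimuraVarieties, Prop. 2.3.10 (PDF p. 32)] -/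
theorem sCompV_smul_form {t : L} (ht : t ≠ 0) (v : Fin n → ℂ) (ρ : Φ.1) : sCompV M j Φ τ (t • H) v ρ = sCompV M j Φ τ H v ρ := by
  by_cases h : ρ.1.comp j = τ
  · rw [sCompV_of_eq v h, sCompV_of_eq v h, smul_map τ t H, reflH_smul_form _ ((map_ne_zero τ).mpr ht)]
  · rw [sCompV_of_ne v h, sCompV_of_ne v h]

/-- `sMatV`: unchanged under `H ↦ t • H`, `t ≠ 0`. [cite: Deligne1979ShimuraVarieties, Prop. 2.3.10 (PDF p. 32)] -/
theorem sMatV_smul_form {t : L} (ht : t ≠ 0) (v : Fin n → ℂ) : sMatV M j Φ τ (t • H) v = sMatV M j Φ τ H v :=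
  matrix_eq_of_realEmb_eq M Φ fun ρ => by rw [sMatV_map_realEmb, sMatV_map_realEmb, sCompV_smul_form M j Φ τ H ht]

/-- **`s_v ∈ GL_n(ℝ ⊗ M)` is unchanged under `H ↦ t • H`**, `t ≠ 0`. [cite: Deligne1979ShimuraVarieties, Prop. 2.3.10 (PDF p. 32)]
[cite: RapoportSmithlingZhang2020Diagonal, Remark 3.2 (iii) p. 10] -/
theorem sPhiV_smul_form {t : L} (ht : t ≠ 0) (v : Fin n → ℂ) : sPhiV M j Φ τ (t • H) v = sPhiV M j Φ τ H v :=
  Units.ext (sMatV_smul_form M j Φ τ H ht v)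

end SPhi

/-! ### §3. Frames for `(H, ξ)` are frames for `(t • H, ξ / j(t))`; the complex structure agrees -/

section Frame

variable {L : Type} [Field L] {M : Type} [Field M] [NumberField M] [IsCMField M] {j : L →+* M}
  {n : ℕ} {H : Matrix (Fin n) (Fin n) L} {ξ : M} {g : ℕ} {δ : Fin g → ℕ}

omit [NumberField M] [IsCMField M] in
/-- `(ξ/j(t)) · (t•H)^j = ξ · H^j`. [cite: Milne2005ShimuraVarieties, §8 p. 81] -/
theorem auxGramV_smul_form {t : L} (ht : t ≠ 0) : auxGramV M j (t • H) (ξ * (j t)⁻¹) = auxGramV M j H ξ := by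
  rw [auxGramV, auxGramV, smul_map j t H, smul_smul, inv_mul_cancel_right₀ ((map_ne_zero j).mpr ht)]

/-- **`ψ_{t•H, ξ/j(t)} = ψ_{H, ξ}`.** [cite: Milne2005ShimuraVarieties, §8 p. 81] -/
theorem auxFormV_smul_form {t : L} (ht : t ≠ 0) : auxFormV M j (t • H) (ξ * (j t)⁻¹) = auxFormV M j H ξ := by
  rw [auxFormV, auxFormV, auxGramV_smul_form ht]

/-- **A symplectic frame for `(H, ξ)` gives one for `(t • H, ξ/j(t))` with the SAME coordinates `β`.** [cite: Milne2005ShimuraVarieties, §6 p. 67, §8 p. 81] -/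
theorem exists_symplecticFrameV_smul_form (F : SymplecticFrameV M j H ξ g δ) {t : L} (ht : t ≠ 0) :
    ∃ F' : SymplecticFrameV M j (t • H) (ξ * (j t)⁻¹) g δ, F'.β = F.β :=
  ⟨⟨F.β, fun v w => by rw [auxFormV_smul_form ht]; exact F.gram v w⟩, rfl⟩

variable {H' : Matrix (Fin n) (Fin n) L} {ξ' : M}

/-- Frames with the same `β` have the same `P`. [cite: Milne2005ShimuraVarieties, §6 p. 67] -/
theorem framePV_eq_of_β_eq (F' : SymplecticFrameV M j H' ξ' g δ) (F : SymplecticFrameV M j H ξ g δ) (hβ : F'.β = F.β) :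
    framePV F' = framePV F := by
  rw [framePV, framePV, hβ]

/-- Frames with the same `β` have the same `Q`. [cite: Milne2005ShimuraVarieties, §6 p. 67] -/
theorem frameQV_eq_of_β_eq (F' : SymplecticFrameV M j H' ξ' g δ) (F : SymplecticFrameV M j H ξ g δ) (hβ : F'.β = F.β) :
    frameQV F' = frameQV F := by
  rw [frameQV, frameQV, hβ]

/-- Frames with the same `β` have the same similitude representation on `R`-points. [cite: Milne2005ShimuraVarieties, §8 p. 81] -/
theorem auxRepV_eq_of_β_eq (R : Type) [CommRing R] [Algebra ℚ R] (F' : SymplecticFrameV M j H' ξ' g δ) (F : SymplecticFrameV M j H ξ g δ)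
    (hβ : F'.β = F.β) : auxRepV R F' = auxRepV R F := by
  obtain ⟨β', g'⟩ := F'
  obtain ⟨β, g⟩ := F
  simp only at hβ
  subst hβ
  rfl

/-- **`J_Φ(v)` read in a frame for `(t • H, ξ')` with the same `β` is `J_Φ(v)` read in the frame for `(H, ξ)`** (`t ≠ 0`): Deligne's `h(i)` sees the form
only through the line reflection. [cite: Deligne1979ShimuraVarieties, Prop. 2.3.10 (PDF p. 32)] [cite: RapoportSmithlingZhang2020Diagonal, Remark 3.2 (iii) p. 10] -/
theorem auxComplexStructureV_eq_of_β_eq_smul {t : L} (F' : SymplecticFrameV M j (t • H) ξ' g δ) (F : SymplecticFrameV M j H ξ g δ)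
    (hβ : F'.β = F.β) (ht : t ≠ 0) (τ : L →+* ℂ) (Φ : CMType M) (v : Fin n → ℂ) :
    auxComplexStructureV F' τ Φ v = auxComplexStructureV F τ Φ v := by
  rw [auxComplexStructureV_def, auxComplexStructureV_def, sPhiV_smul_form M j Φ τ H ht, auxRepV_eq_of_β_eq ℝ F' F hβ]

end Frame

end AuxV

/-! ### §4. The curve: positivity of `J_Φ(v)` from a signature datum for `t • J⋆` -/

open Literature.AlgebraicGeometry.ShimuraVarieties.UnitaryCurve.AuxV

section Curve

variable {L : Type} [Field L] [NumberField L] [IsCMField L] {Jstar : Matrix (Fin 2) (Fin 2) L} {τ : L →+* ℂ}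
variable {g : ℕ} {δ : Fin g → ℕ} {N : ℕ}

/-- An element real at one complex embedding is fixed by complex conjugation. [cite: Milne2005ShimuraVarieties, §8 p. 81] -/
theorem complexConj_eq_self_of_im_eq_zero {t : L} (h : (τ t).im = 0) : IsCMField.complexConj L t = t :=
  τ.injective (by rw [IsCMField.complexEmbedding_complexConj, Complex.conj_eq_iff_im.mpr h])

/-- `ᵗc(t • J⋆) = t • J⋆` for `J⋆` hermitian and `t` real at `τ`. [cite: RapoportSmithlingZhang2020Diagonal, §3.1 p. 8] -/
theorem transpose_map_complexConj_smul (hJ : (Jstar.map (IsCMField.complexConj L))ᵀ = Jstar) {t : L} (h : (τ t).im = 0) :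
    ((t • Jstar).map (IsCMField.complexConj L))ᵀ = t • Jstar := by
  rw [smul_map (IsCMField.complexConj L) t Jstar, Matrix.transpose_smul, hJ, complexConj_eq_self_of_im_eq_zero h]

omit [NumberField L] [IsCMField L] in
/-- The negative cone of `(t • J⋆)^τ` is that of `J⋆^τ` for `τ(t) > 0`. [cite: BergeronMillsonMoeglin2016Balls, Part 2 §1.3] -/
theorem negCone_map_smul_eq {t : L} (hτt : 0 < (τ t).re) (hτt' : (τ t).im = 0) : negCone ((t • Jstar).map τ) = negCone (Jstar.map τ) := by
  rw [smul_map τ t Jstar, UnitaryBallUniformisationDatum.negCone_smul_eq_of_pos _ hτt hτt']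

omit [NumberField L] [IsCMField L] in
/-- `0 < Re τ(t)` forces `t ≠ 0`. [cite: Milne2005ShimuraVarieties, §8 p. 81] -/
theorem ne_zero_of_re_pos {t : L} (hτt : 0 < (τ t).re) : t ≠ 0 := by
  rintro rfl
  rw [map_zero, Complex.zero_re] at hτt
  exact lt_irrefl _ hτt

/-- **`J_Φ(v) ∈ C0pm δ` ON THE NEGATIVE CONE OF `J⋆^τ`, FROM A SIGNATURE DATUM FOR `t • J⋆`** (`t` real positive at `τ`, a Sylvester frame `T` of
`(t•J⋆)^τ`, definiteness of `(t•J⋆)^σ` off `τ`, `τ ∈ Φ`, `Im ρ(ξ/t) < 0` on `Φ`): ★ E2 A3 `auxComplexStructureV_mem_C0pm_of_frame` for the rescaled frame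
(§3) and `negCone ((t•J⋆)^τ) = negCone (J⋆^τ)`.  This is E3's `hJ` at the E-line's `SigDatum`. [cite: Deligne1979ShimuraVarieties, Prop. 2.3.10 (PDF p. 32)]
[cite: Milne2005ShimuraVarieties, §6 pp. 68–69] -/
theorem auxComplexStructureV_mem_C0pm_of_sigDatum {ξ : L} (F : SymplecticFrameV L (RingHom.id L) Jstar ξ g δ) (Φ : CMType L) (hΦ : τ ∈ Φ.1)
    (hJ : (Jstar.map (IsCMField.complexConj L))ᵀ = Jstar) {t : L} (hτt : 0 < (τ t).re) (hτt' : (τ t).im = 0)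
    (hξ : ∀ ρ : Φ.1, (ρ.1 (ξ * t⁻¹)).im < 0) (T : GL (Fin 2) ℂ)
    (hT : (T : Matrix (Fin 2) (Fin 2) ℂ)ᴴ * (t • Jstar).map τ * (T : Matrix (Fin 2) (Fin 2) ℂ) = signatureMatrix 1)
    (hpos : ∀ σ : L →+* ℂ, InfinitePlace.mk σ ≠ InfinitePlace.mk τ → ((t • Jstar).map σ).PosDef)
    (v : Fin 2 → ℂ) (hv : v ∈ negCone (Jstar.map τ)) : auxComplexStructureV F τ Φ v ∈ C0pm δ := by
  obtain ⟨F', hβ⟩ := exists_symplecticFrameV_smul_form F (ne_zero_of_re_pos hτt)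
  have hv' : v ∈ negCone ((t • Jstar).map τ) := by rwa [negCone_map_smul_eq hτt hτt']
  rw [← auxComplexStructureV_eq_of_β_eq_smul F' F hβ (ne_zero_of_re_pos hτt) τ Φ v]
  exact auxComplexStructureV_mem_C0pm_of_frame F' Φ hΦ hξ (transpose_map_complexConj_smul hJ hτt') _ _ hT T.mul_inv hpos v hv'

/-- **`−J_Φ(v) ∈ C0 δ`** from the same signature datum (E3's `hJneg`). [cite: Deligne1979ShimuraVarieties, Prop. 2.3.10 (PDF p. 32)]
[cite: Milne2005ShimuraVarieties, §6 pp. 68–69] -/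
theorem neg_auxComplexStructureV_mem_C0_of_sigDatum {ξ : L} (F : SymplecticFrameV L (RingHom.id L) Jstar ξ g δ) (Φ : CMType L) (hΦ : τ ∈ Φ.1)
    (hJ : (Jstar.map (IsCMField.complexConj L))ᵀ = Jstar) {t : L} (hτt : 0 < (τ t).re) (hτt' : (τ t).im = 0)
    (hξ : ∀ ρ : Φ.1, (ρ.1 (ξ * t⁻¹)).im < 0) (T : GL (Fin 2) ℂ)
    (hT : (T : Matrix (Fin 2) (Fin 2) ℂ)ᴴ * (t • Jstar).map τ * (T : Matrix (Fin 2) (Fin 2) ℂ) = signatureMatrix 1)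
    (hpos : ∀ σ : L →+* ℂ, InfinitePlace.mk σ ≠ InfinitePlace.mk τ → ((t • Jstar).map σ).PosDef)
    (v : Fin 2 → ℂ) (hv : v ∈ negCone (Jstar.map τ)) : -auxComplexStructureV F τ Φ v ∈ C0 δ := by
  obtain ⟨F', hβ⟩ := exists_symplecticFrameV_smul_form F (ne_zero_of_re_pos hτt)
  have hv' : v ∈ negCone ((t • Jstar).map τ) := by rwa [negCone_map_smul_eq hτt hτt']
  rw [← auxComplexStructureV_eq_of_β_eq_smul F' F hβ (ne_zero_of_re_pos hτt) τ Φ v]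
  exact neg_auxComplexStructureV_mem_C0_of_frame F' Φ hΦ hξ (transpose_map_complexConj_smul hJ hτt') _ _ hT T.mul_inv hpos v hv'

/-- **A skew `ξ` adapted to `Φ` after division by `t`** (`t` real at `τ`, `t ≠ 0`): `ξ ≠ 0`, `c ξ = −ξ`, `Im ρ(ξ/t) < 0` on `Φ`, and the sign survives
`ξ ↦ k•ξ` (`k > 0`, E1's rescaling ★ `exists_symplecticFrameV_integralAction`).  Take `ξ := ξ₀·t` with `ξ₀` `Φ`-adapted (★ `exists_skew_adapted`).
[cite: Shimura1998, §6.2 Thm. 3 (proof, pp. 37–38)] [cite: Milne2005ShimuraVarieties, §6 p. 68] -/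
theorem exists_xi_of_sigDatum (Φ : CMType L) {t : L} (hτt : 0 < (τ t).re) (hτt' : (τ t).im = 0) :
    ∃ ξ : L, ξ ≠ 0 ∧ IsCMField.complexConj L ξ = -ξ ∧ (∀ ρ : Φ.1, (ρ.1 (ξ * t⁻¹)).im < 0) ∧
      ∀ k : ℕ, 0 < k → ∀ ρ : Φ.1, (ρ.1 (((k : ℚ) • ξ) * t⁻¹)).im < 0 := by
  have ht : t ≠ 0 := ne_zero_of_re_pos hτt
  obtain ⟨ζ, hζc, hζ0, hζ⟩ := Literature.AlgebraicGeometry.Deligne1982.SplitCriterion.exists_skew_adapted Φ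
  have hξ₀ : ∀ ρ : Φ.1, (ρ.1 (-ζ)).im < 0 := fun ρ => by
    rw [map_neg, Complex.neg_im, neg_lt_zero]
    exact (hζ ρ.1).1 ρ.2
  refine ⟨-ζ * t, mul_ne_zero (neg_ne_zero.mpr hζ0) ht, ?_, fun ρ => ?_, fun k hk ρ => ?_⟩
  · rw [map_mul, map_neg, hζc, neg_neg, complexConj_eq_self_of_im_eq_zero hτt', neg_mul, neg_neg]
  · rw [mul_inv_cancel_right₀ ht]
    exact hξ₀ ρ
  · rw [smul_mul_assoc, mul_inv_cancel_right₀ ht]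
    exact im_ringHom_nat_smul_neg (-ζ) ρ.1 hk (hξ₀ ρ)

/-! ### §5. The Siegel chart with movers at the E-line's signature datum -/

/-- **THE SIEGEL CHART OF THE UNITARY SHIMURA CURVE AT `J_Φ`, WITH MOVERS, FROM A SIGNATURE DATUM FOR `t • J⋆`** — ★
`exists_siegelChartGS_auxComplexStructureV_mover` with its positivity binders `(T Ti hT hTi hpos)` at `J⋆` and `hξ` replaced by the `SigDatum`-shaped
ones (`t`, `0 < Re τ t`, `Im τ t = 0`, `Im ρ(ξ/t) < 0` on `Φ`, `T : GL₂(ℂ)` with `Tᴴ (t•J⋆)^τ T = diag(1,−1)`, `(t•J⋆)^σ ≻ 0` off `τ`); conclusion VERBATIM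
(pieces, uniformisations, `f`, `piece`, `Z`, principal representatives, `pts`, `f_mk`, shadow, admissibility, classification, movers (Q)), the two
`SiegelShimuraSet.mk` membership proofs being the §4 ones.  Proof: the same ★ E3 FILE D `exists_siegelChartGS_mover` call.
[cite: Deligne1979ShimuraVarieties, Prop. 2.3.10 (PDF p. 32)] [cite: Milne2005ShimuraVarieties, Lemma 5.13 p. 57, Thm. 6.11 p. 74]
[cite: RapoportSmithlingZhang2020Diagonal, Remark 3.2 (ii)(iii) pp. 9–10 and Prop. 3.7 pp. 13–14] -/
theorem exists_siegelChartGS_auxComplexStructureV_mover_of_sigDatum (hU : siegelModuli_complexUniformisation) (hg : 0 < g)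
    (hδ : IsPolarizationType δ) (hN : 3 ≤ N) (𝓜 : SiegelFineModuliScheme g N δ)
    (Φ : CMType L) (hΦ : τ ∈ Φ.1) {ξ : L} (F : SymplecticFrameV L (RingHom.id L) Jstar ξ g δ)
    (hJ : (Jstar.map (IsCMField.complexConj L))ᵀ = Jstar) {t : L} (hτt : 0 < (τ t).re) (hτt' : (τ t).im = 0)
    (hξ : ∀ ρ : Φ.1, (ρ.1 (ξ * t⁻¹)).im < 0) (T : GL (Fin 2) ℂ)
    (hT : (T : Matrix (Fin 2) (Fin 2) ℂ)ᴴ * (t • Jstar).map τ * (T : Matrix (Fin 2) (Fin 2) ℂ) = signatureMatrix 1)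
    (hpos : ∀ σ : L →+* ℂ, InfinitePlace.mk σ ≠ InfinitePlace.mk τ → ((t • Jstar).map σ).PosDef)
    (K : Subgroup ↥(finAdelic (↥(maximalRealSubfield L)) L (IsCMField.complexConj L) 2 Jstar))
    (hle : K ≤ (principalLevelSubgroup δ N).comap ((auxToGspFinV F).comp (MonoidHom.inl _ _))) :
    haveI : IsLocallyNoetherian (specOver ℚ ℂ).left := inferInstanceAs (IsLocallyNoetherian (Spec (CommRingCat.of ℂ)))
    ∃ (Sc : (ZMod N)ˣ → SchemeOver ℂ) (ιc : ∀ c, Sc c ⟶ (Motives.baseChange ℚ ℂ).obj 𝓜.M)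
      (unif : ∀ _c : (ZMod N)ˣ, Matrix (Fin g) (Fin g) ℂ → ComplexPoints (Sc _c))
      (f : ShimuraSetGS L Jstar τ K → ComplexPoints 𝓜.M)
      (piece : ↥(finAdelic (↥(maximalRealSubfield L)) L (IsCMField.complexConj L) 2 Jstar) → (ZMod N)ˣ)
      (Z : ↥(finAdelic (↥(maximalRealSubfield L)) L (IsCMField.complexConj L) 2 Jstar) → (Fin 2 → ℂ) → Matrix (Fin g) (Fin g) ℂ)
      (u : (ZMod N)ˣ → finAdeleQˣ) (rep : (ZMod N)ˣ → ↥(gspFinAdelic δ))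
      (pts : ComplexPoints ((Motives.baseChange ℚ ℂ).obj 𝓜.M) ≃ SiegelShimuraSet δ (principalLevelSubgroup δ N))
      (q : ↥(finAdelic (↥(maximalRealSubfield L)) L (IsCMField.complexConj L) 2 Jstar) → ↥(gspRational δ)),
    -- (U1) component cofan of irreducible pieces
      Nonempty (IsColimit (Cofan.mk ((Motives.baseChange ℚ ℂ).obj 𝓜.M) ιc)) ∧
      (∀ c, IrreducibleSpace (Sc c).left) ∧
    -- (U2+) analytic clauses per piece
      (∀ c, ContinuousOn (unif c) (siegelUpperHalfSpace g)) ∧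
      (∀ c, IsOpenMap ((siegelUpperHalfSpace g).restrict (unif c))) ∧
      (∀ c, Set.SurjOn (unif c) (siegelUpperHalfSpace g) Set.univ) ∧
      (∀ c, ∀ W ∈ siegelUpperHalfSpace g, ∀ W' ∈ siegelUpperHalfSpace g,
        unif c W = unif c W' ↔ ∃ M ∈ siegelLevelGroup δ N, ∃ C : (Fin g → ℂ) ≃ₗ[ℂ] (Fin g → ℂ),
          ∀ x : Fin g ⊕ Fin g → ℝ, C (siegelPeriodMap δ W x) = siegelPeriodMap δ W' (intAct M x)) ∧
      (∀ (c : (ZMod N)ˣ) (U : (Sc c).left.affineOpens) (s : (Sc c).left.presheaf.obj (Opposite.op (↑U : (Sc c).left.Opens))),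
        DifferentiableOn ℂ (fun W ↦ AlgPoints.evalOrZero (↑U : (Sc c).left.Opens) s (unif c W))
          (siegelUpperHalfSpace g ∩ unif c ⁻¹' {P | P.pt ∈ (↑U : (Sc c).left.Opens)})) ∧
    -- principal representatives (the five (U3) premisses)
      (∀ c, (∀ w, Valued.v ((u c : finAdeleQ) w) = 1) ∧ (u c : finAdeleQ) - ((c : ZMod N).val : ℕ) ∈ levelIdeal N ∧
        rep c ∈ principalLevelSubgroup δ 1 ∧
          IsMultiplier (typeFormOver δ finAdeleQ) (rep c : GL (Fin g ⊕ Fin g) finAdeleQ) (u c) ∧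
            ((rep c : GL (Fin g ⊕ Fin g) finAdeleQ) : Matrix (Fin g ⊕ Fin g) (Fin g ⊕ Fin g) finAdeleQ) =
              Matrix.fromBlocks 1 0 0 ((u c : finAdeleQ) • (1 : Matrix (Fin g) (Fin g) finAdeleQ))) ∧
    -- (P) the point map: `Z_hol`, `Z_mem`, `f_mk`, the Shimura-set shadow
      (∀ a (i j : Fin g), DifferentiableOn ℂ (fun v => Z a v i j) (negCone (Jstar.map τ))) ∧
      (∀ a (v : Fin 2 → ℂ), v ∈ negCone (Jstar.map τ) → Z a v ∈ siegelUpperHalfSpace g) ∧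
      (∀ (v : Fin 2 → ℂ) (hv : v ∈ negCone (Jstar.map τ)) a,
        f (ShimuraSetGS.mk L Jstar τ K v hv a) =
          (AlgPoints.baseChangeEquiv (algebraMap ℚ ℂ) 𝓜.M).symm (AlgPoints.map (ιc (piece a)) (unif (piece a) (Z a v)))) ∧
      (∀ (v : Fin 2 → ℂ) (hv : v ∈ negCone (Jstar.map τ)) a,
        pts (AlgPoints.baseChangeEquiv (algebraMap ℚ ℂ) 𝓜.M (f (ShimuraSetGS.mk L Jstar τ K v hv a))) =
          SiegelShimuraSet.mk δ (principalLevelSubgroup δ N) ⟨auxComplexStructureV F τ Φ v,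
            auxComplexStructureV_mem_C0pm_of_sigDatum F Φ hΦ hJ hτt hτt' hξ T hT hpos v hv⟩ (((auxToGspFinV F).comp (MonoidHom.inl _ _)) a)) ∧
      (∀ (v : Fin 2 → ℂ) (hv : v ∈ negCone (Jstar.map τ)) a, ∃ hZv : Z a v ∈ siegelUpperHalfSpace g,
        SiegelShimuraSet.mk δ (principalLevelSubgroup δ N) ⟨auxComplexStructureV F τ Φ v,
            auxComplexStructureV_mem_C0pm_of_sigDatum F Φ hΦ hJ hτt hτt' hξ T hT hpos v hv⟩ (((auxToGspFinV F).comp (MonoidHom.inl _ _)) a) =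
          SiegelShimuraSet.mk δ (principalLevelSubgroup δ N)
            ⟨jOfSiegel δ (Z a v), C0_subset_C0pm δ (jOfSiegel_mem_C0 hδ.1 hZv)⟩ (rep (piece a))) ∧
      (∀ (c : (ZMod N)ˣ) (W : Matrix (Fin g) (Fin g) ℂ) (hW : W ∈ siegelUpperHalfSpace g),
        pts (AlgPoints.map (ιc c) (unif c W)) =
          SiegelShimuraSet.mk δ (principalLevelSubgroup δ N) ⟨jOfSiegel δ W, C0_subset_C0pm δ (jOfSiegel_mem_C0 hδ.1 hW)⟩ (rep c)) ∧
    -- (A) admissibility of the universal triple at the image point ((U3∃)) and classification ((U3-D3))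
      (∀ (v : Fin 2 → ℂ) (hv : v ∈ negCone (Jstar.map τ)) a, ∃ hZv : Z a v ∈ siegelUpperHalfSpace g,
        (∃ (P' : PolarizedAbelianSchemeWithLevel g N δ (specOver ℚ ℂ).left)
            (G : P'.A.X.left ⟶ 𝓜.univ.A.X.left) (Ĝ : P'.D.hat.X.left ⟶ 𝓜.univ.D.hat.X.left),
            P'.IsBaseChangeVia 𝓜.univ (f (ShimuraSetGS.mk L Jstar τ K v hv a)).left G Ĝ ∧
              IsAdmissibleAt hδ (rep (piece a)) (Z a v) hZv P') ∧
        ∀ P' : PolarizedAbelianSchemeWithLevel g N δ (specOver ℚ ℂ).left, IsAdmissibleAt hδ (rep (piece a)) (Z a v) hZv P' →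
          f (ShimuraSetGS.mk L Jstar τ K v hv a) = 𝓜.classifyingMap (specOver ℚ ℂ) P') ∧
    -- (Q) THE MOVERS: `Z a` is E2's period function in the frame `(q a)_ℝ⁻¹`, `q a` tied to `a` adelically
      (∀ (v : Fin 2 → ℂ), v ∈ negCone (Jstar.map τ) → ∀ a,
        conjJ (((gspRationalToReal δ (q a))⁻¹ : ↥(gspReal δ)) : GL (Fin g ⊕ Fin g) ℝ) (auxComplexStructureV F τ Φ v) = jOfSiegel δ (Z a v) ∧
          gspRationalToFinAdelic δ (q a) • ((rep (piece a) : gspFinAdelic δ) : gspFinAdelic δ ⧸ principalLevelSubgroup δ N) =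
            ((((auxToGspFinV F).comp (MonoidHom.inl _ _)) a : gspFinAdelic δ) : gspFinAdelic δ ⧸ principalLevelSubgroup δ N)) :=
  exists_siegelChartGS_mover (auxComplexStructureV F τ Φ)
    (auxComplexStructureV_mem_C0pm_of_sigDatum F Φ hΦ hJ hτt hτt' hξ T hT hpos)
    ((auxToGspFinV F).comp (MonoidHom.inl _ _)) ((auxToGspRatV F).comp (MonoidHom.inl _ _)) hU hg hδ hN 𝓜
    (neg_auxComplexStructureV_mem_C0_of_sigDatum F Φ hΦ hJ hτt hτt' hξ T hT hpos)
    (fun _ hc v _ => auxComplexStructureV_smul F τ Φ v hc) (hb_auxToGspFinV_inl F)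
    (auxComplexStructureV_hJrat F τ Φ (negCone (Jstar.map τ))) K hle
    (fun γ _ hC => periodChartV L F Φ τ hδ.1 γ hC)

end Curve

end UnitaryCurve

end Literature.AlgebraicGeometry.ShimuraVarieties

end
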